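import Summits.NavierStokesRegularity.NavierStokesRegularity.Theorems.ScenarioCensusRowF1ax
import Summits.NavierStokesRegularity.NavierStokesRegularity.Theorems.TypeICertificateLadderRungZero
import Literature.Analysis.FluidPDE.BarkerPrange2020VorticityAlignmentTypeIHolds
import Literature.Analysis.FluidPDE.TypeIAncientMildTimeAnalytic
import HarnessLib
import Summits.NavierStokesRegularity.NavierStokesRegularity.Theorems.ScenarioCensusRowF1SnapshotTopRigid

/-!
# Census row F1, criteria read on NEEDLES — codimension-2 radial segments at SNAPSHOTS (cells F1nd / F1ne / F1sc; floors HF / SWF) — LINE 37 «needle-top» port, part 1/3: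
# §1 objects (top, Type-I constant, Leray's snapshot level — LINES 34/35/36 BY NAME; calm NEEDLES at one instant `CalmNeedlesAt`; the rows `Row_F1nd` / `Row_F1ne`);
# §2 COMPACTNESS of `𝒦_M` with LOCALLY UNIFORM slices and the socket lemma; §3 Leray's every-time floor (BY NAME) and the snapshot zoom package (locally uniform clause)

Re-homed for the scenario census (typer seat ns-census-typer-1 g10; the cells F1nd / F1ne / F1sc and the floors HF / SWF are MEMBERS OF RECORD «DECIDED IN KERNEL IN FILES» of row F1
(item 78: critic idea-crit-3 g9 PASS no price 11:16:43Z; ref PRE-CHECK ✓; lead label LBL78); this port makes them TREE-decided): VERBATIM PORT of ns-idea-3 LINE 37 «needle-top»,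
`pub/ideators/ns-idea-3/lines/needle-top/line-needle-top.lean` sha16 a98a4df70fd31916 (1057 l., lean check rc 0, 0 sorry), split for the 400-line rule into
`ScenarioCensusRowF1NeedleTop` (§1–§3) → `…NeedleTopRows` (§4–§5) → `…NeedleTopSector` (§6–§7 + census KEYS).  Lean text VERBATIM in namespace
`…Theorems.ScenarioCensus.NeedleTop` (the line's `…Cruxes.ScenarioCensusRowF1.NeedleTopLine` re-homed); port edits: the frame restated VERBATIM by the line from LINES 34/35/36
and «caged-top» (`topSet`, `HasTypeIConstant`, `snapLevel`, `exists_fast_at`, `CalmPocketsAt`, `Row_F1cs`, `HasPorousTopAt`, `IsSubcriticalLevel`, `HasPorousTop`, `Row_F1po`, order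
lemmas) is taken BY NAME from the landed two-time-top / one-level-top / snapshot-top ports; the second proof terms `rowF1cs_holds` / `rowF1po_holds` are not re-declared
(routes `rowF1cs_of_rowF1nd rowF1nd_holds`, `rowF1po_of_rowF1nd rowF1nd_holds`); the line's NEW compactness / socket / zoom package WITH the locally-uniform clause
(`limitClass_compact`, `exists_level_of_limitKill`, `exists_snapshotZoom_package`) are kept verbatim (new statements); the bookkeeping lemma `tendstoLocallyUniformly_comp_of_tendsto` (a twin of a landed lemma in a route-cone module) is not re-declared, its 3-line proof is inlined at the one use site; `@[conjecture]` on the residual `NeedleCollapse`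
(≡ `ScenarioCensus.Row_F1`, OPEN); one-line docstrings added where missing (gate lint).  Statements untouched.

No census VALUE is moved here (row F1 stays OPEN-WITH-LINE; the members become TREE-decided by name); NS regularity is NOT proved; `Row_F1` is untouched (zero
movement, `needleCollapse_iff_rowF1`); no summit statement is proved by this file. Lemmas that restate already-landed tree declarations are taken BY NAME (gate lint `dedup.landed`): `topSet` = `TwoTimeTop.topSet`, `HasTypeIConstant` = `OneLevelTop.HasTypeIConstant`, `snapLevel` = `SnapshotTop.snapLevel`, `exists_fast_at` = `SnapshotTop.exists_fast_at`, `sqrt_mul_sq_mul` = `SnapshotTop.sqrt_mul_sq_mul`, `CalmPocketsAt` = `SnapshotTop.CalmPocketsAt`, `Row_F1cs` = `SnapshotTop.Row_F1cs`, `HasPorousTopAt` = `SnapshotTop.HasPorousTopAt`, `IsSubcriticalLevel` = `SnapshotTop.IsSubcriticalLevel`, `HasPorousTop` = `SnapshotTop.HasPorousTop`, `Row_F1po` = `SnapshotTop.Row_F1po`, `eventually_calmPocketsAt_of_porous` = `SnapshotTop.eventually_calmPocketsAt_of_porous`, `rowF1po_of_rowF1cs` = `SnapshotTop.rowF1po_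of_rowF1cs`.
-/

-- the summit and its single problem share the name `NavierStokesRegularity` (D-0017 nested layout)
set_option linter.dupNamespace false

noncomputable section

open MeasureTheory Set Function Filter TopologicalSpace Metric
open scoped Topology NNReal ENNReal InnerProductSpace

namespace Summit.NavierStokesRegularity.NavierStokesRegularity.Theorems.ScenarioCensus.NeedleTop

open Literature.Analysis Literature.Analysis.FluidPDE
open Summit.NavierStokesRegularity.NavierStokesRegularity.Theorems
open Summit.NavierStokesRegularity.NavierStokesRegularity.Theses

/-- `ℝ³`. -/
abbrev E3 := EuclideanSpace ℝ (Fin 3)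

/-! ## §1 Objects: top, dimensionless Type-I constant, Leray's snapshot level `c_S`, CALM NEEDLES at ONE instant; the rows -/

-- `topSet`: the line restates the tree's `TwoTimeTop.topSet`; taken BY NAME (gate lint dedup.landed).

-- `HasTypeIConstant`: the line restates the tree's `OneLevelTop.HasTypeIConstant`; taken BY NAME (gate lint dedup.landed).

-- `snapLevel`: the line restates the tree's `SnapshotTop.snapLevel`; taken BY NAME (gate lint dedup.landed).

/-- **Calm needles at ONE instant `t`** (level `Λ`, reach `A`, length `a`, calm threshold `ε`; the parabolic unit is
`ℓ = √(ν(T − t))`, the speed unit `√ν/√(T − t)`): every `Λ`-fast point `x` carries a RADIAL NEEDLE — a unit direction `e` and a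
start `r₀ ∈ [0, A]` — such that on the segment `{x + r ℓ e : r ∈ [r₀, r₀ + a]}` the DIMENSIONLESS speed is `≤ ε`.  The segment has
no interior and zero volume; what matters is that ITS CARRIER LINE PASSES THROUGH THE FAST POINT `x`.  A condition on the single
snapshot `u(t, ·)`. -/
def CalmNeedlesAt (ν T : ℝ) (u : ℝ → E3 → E3) (Λ A a ε t : ℝ) : Prop :=
  ∀ x ∈ TwoTimeTop.topSet ν T u Λ t, ∃ e : E3, ‖e‖ = 1 ∧ ∃ r₀ ∈ Icc (0 : ℝ) A,
    ∀ r ∈ Icc r₀ (r₀ + a),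
      Real.sqrt (T - t) * ‖u t (x + (r * Real.sqrt (ν * (T - t))) • e)‖ ≤ ε * Real.sqrt ν

/-- **ROW F1nd «CALM-NEEDLE SNAPSHOTS»** (Type I · no symmetry · Clay class; PROVED, `rowF1nd_holds`): for every dimensionless
Type-I constant `M`, reach `A` and length `a > 0` there is `ε = ε(M, A, a) > 0` such that: if along SOME sequence of instants
`t_k ↑ T` (an `∃ᶠ`-hypothesis) every `c_S`-fast point carries an `ε`-calm radial needle of length `a ℓ` starting within `A ℓ`,
the solution extends smoothly past `T`. -/
def Row_F1nd : Prop :=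
  ∀ (M A a : ℝ), 0 < a → ∃ ε : ℝ, 0 < ε ∧
    ∀ (ν T : ℝ), 0 < ν → 0 < T → ∀ (u : ℝ → E3 → E3) (p : ℝ → E3 → ℝ),
    IsClassicalNSSolutionOn (Ico 0 T) ν 0 u p → IsLerayHopfOn T ν 0 (u 0) u →
    HasRapidSpatialDecay (u 0) → OneLevelTop.HasTypeIConstant ν T M u →
    (∃ᶠ t in 𝓝[<] T, CalmNeedlesAt ν T u SnapshotTop.snapLevel A a ε t) →
    HasSmoothExtensionPast ν 0 u T

/-- **ROW F1ne «CALM NEEDLES, EVENTUALLY»** (the `∀ᶠ`-form; a formal COROLLARY of `Row_F1nd`, `rowF1ne_of_rowF1nd`). -/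
def Row_F1ne : Prop :=
  ∀ (M A a : ℝ), 0 < a → ∃ ε : ℝ, 0 < ε ∧
    ∀ (ν T : ℝ), 0 < ν → 0 < T → ∀ (u : ℝ → E3 → E3) (p : ℝ → E3 → ℝ),
    IsClassicalNSSolutionOn (Ico 0 T) ν 0 u p → IsLerayHopfOn T ν 0 (u 0) u →
    HasRapidSpatialDecay (u 0) → OneLevelTop.HasTypeIConstant ν T M u →
    (∀ᶠ t in 𝓝[<] T, CalmNeedlesAt ν T u SnapshotTop.snapLevel A a ε t) →
    HasSmoothExtensionPast ν 0 u T

/-- Order: the calm-needle snapshot row implies its eventual form. -/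
theorem rowF1ne_of_rowF1nd (h : Row_F1nd) : Row_F1ne := by
  intro M A a ha
  obtain ⟨ε, hε, hrow⟩ := h M A a ha
  exact ⟨ε, hε, fun ν T hν hT u p hsol hLH hdec hM hev => hrow ν T hν hT u p hsol hLH hdec hM hev.frequently⟩

/-! ## §2 COMPACTNESS of `𝒦_M` (values pointwise AND locally uniformly on slices, gradients pointwise) and the SOCKET LEMMA

`𝒦_M` = `IsTypeIAncientMild M`.  The tree's extraction theorem `exists_tendsto_of_typeI_seq_Ioo` (KNSS 2009, Lemma 6.1) fed with
MEMBERS of `𝒦_M` is the sequential compactness of `𝒦_M`; LINE 36 recorded pointwise values and gradients, this line ALSO keeps the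
extraction theorem's third output — LOCALLY UNIFORM convergence of every slice — because a needle read along the zoom MOVES (its
direction `e_j` and start `r₀_j` depend on `j`) and converges only after a further compactness step on `(e_j, r₀_j)`; evaluating a
locally uniformly convergent sequence along a convergent sequence of points (`TendstoLocallyUniformly.tendsto_comp`) is what reads
the calm needle on the limit slice. -/

/-- **Compactness of `𝒦_M`** (pointwise values and gradients, locally uniform values on every slice of the open past). -/
theorem limitClass_compact (M : ℝ) (Wn : ℕ → ℝ → E3 → E3) (h : ∀ n, IsTypeIAncientMild M (Wn n)) :
    ∃ φ : ℕ → ℕ, StrictMono φ ∧ ∃ W : ℝ → E3 → E3, IsTypeIAncientMild M W ∧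
      (∀ t < 0, ∀ y : E3, Tendsto (fun j => Wn (φ j) t y) atTop (𝓝 (W t y))) ∧
      (∀ t < 0, ∀ y : E3, Tendsto (fun j => fderiv ℝ (Wn (φ j) t) y) atTop (𝓝 (fderiv ℝ (W t) y))) ∧
      (∀ t < 0, TendstoLocallyUniformly (fun j => Wn (φ j) t) (W t) atTop) := by
  set A : ℕ → ℝ := fun n => -((n : ℝ) + 1) with hA
  have hAlim : Tendsto A atTop atBot := by
    have h1 : Tendsto (fun n : ℕ => (n : ℝ) + 1) atTop atTop :=
      tendsto_atTop_add_const_right _ _ tendsto_natCast_atTop_atTop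
    exact tendsto_neg_atTop_atBot.comp h1
  have hsub : ∀ n, Ioo (A n) 0 ×ˢ (univ : Set E3) ⊆ Iio 0 ×ˢ univ := fun n =>
    prod_mono (fun t ht => ht.2) subset_rfl
  have hc : ∀ n, ContinuousOn (uncurry (Wn n)) (Ioo (A n) 0 ×ˢ univ) := fun n =>
    (h n).continuousOn_uncurry.mono (hsub n)
  have hdiv : ∀ n, ∀ t ∈ Ioo (A n) 0, IsWeaklyDivFree (Wn n t) := fun n t ht =>
    (h n).isWeaklyDivFree ht.2
  have hmild : ∀ n, ∀ s t : ℝ, A n < s → s < t → t < 0 → ∀ x,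
      Wn n t x = UnboundedOperators.heatExtension (Wn n s) (t - s) x -
        oseenDuhamel 1 s (Wn n) (Wn n) t x :=
    fun n s t _ hst ht x => (h n).mild_eq_heatExtension hst ht x
  have hI : ∀ n, ∀ t ∈ Ioo (A n) 0, ∀ x, ‖Wn n t x‖ ≤ M / Real.sqrt (-t) := fun n t ht x =>
    (h n).norm_le ht.2 x
  obtain ⟨φ, hφ, W, hW, hpt, hgrad, hlu, -⟩ := exists_tendsto_of_typeI_seq_Ioo M hAlim hc hdiv hmild hI
  exact ⟨φ, hφ, W, hW, hpt, hgrad, hlu⟩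

-- `tendstoLocallyUniformly_comp_of_tendsto`: a statement-twin of the landed `AdaptedFrequencyTangentFlowTransfer.tendstoLocallyUniformly_comp_of_tendsto` (whose module imports a route file and is therefore NOT imported here; gate lint dedup.landed); not re-declared — its 3-line folklore proof (subsequences of locally uniformly convergent sequences) is inlined at the use site.

/-- **SOCKET LEMMA (the compactness upgrade; LINE 35/36, locally-uniform clause added).**  Let `P Λ W` be any «defect of `W` below
`Λ`» predicate.  Suppose the LIMIT KILL: whenever members `W_n ∈ 𝒦_M` with `P εₙ W_n`, `εₙ → 0⁺`, converge (values pointwise and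
locally uniformly on slices, gradients pointwise, on the open past) to `W ∈ 𝒦_M`, the limit rests at `(−1, 0)`.  Then there is ONE
LEVEL `Λ₁ = Λ₁(M, κ, P) > 0` such that no `W ∈ 𝒦_M` with `‖W(−1, 0)‖ ≥ κ` has defect below `Λ₁`.  (Contradiction + compactness;
`Λ₁` is ineffective.) -/
theorem exists_level_of_limitKill (M : ℝ) {κ : ℝ} (hκ : 0 < κ) (P : ℝ → (ℝ → E3 → E3) → Prop)
    (hkill : ∀ (Wn : ℕ → ℝ → E3 → E3) (W : ℝ → E3 → E3) (ε : ℕ → ℝ),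
      (∀ n, 0 < ε n) → Tendsto ε atTop (𝓝 0) → (∀ n, IsTypeIAncientMild M (Wn n)) → IsTypeIAncientMild M W →
      (∀ n, P (ε n) (Wn n)) → (∀ t < 0, ∀ y : E3, Tendsto (fun n => Wn n t y) atTop (𝓝 (W t y))) →
      (∀ t < 0, ∀ y : E3, Tendsto (fun n => fderiv ℝ (Wn n t) y) atTop (𝓝 (fderiv ℝ (W t) y))) →
      (∀ t < 0, TendstoLocallyUniformly (fun n => Wn n t) (W t) atTop) →
      W (-1) 0 = 0) :
    ∃ Λ₁ : ℝ, 0 < Λ₁ ∧ ∀ W : ℝ → E3 → E3, IsTypeIAncientMild M W → κ ≤ ‖W (-1) 0‖ → ¬ P Λ₁ W := by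
  by_contra hno
  have hex : ∀ n : ℕ, ∃ W : ℝ → E3 → E3,
      IsTypeIAncientMild M W ∧ κ ≤ ‖W (-1) 0‖ ∧ P (1 / ((n : ℝ) + 1)) W := by
    intro n
    by_contra hn
    exact hno ⟨1 / ((n : ℝ) + 1), by positivity, fun W hW hκW hP => hn ⟨W, hW, hκW, hP⟩⟩
  choose Wn hWn hκn hPn using hex
  obtain ⟨φ, hφ, W, hW, hpt, hgrad, hlu⟩ := limitClass_compact M Wn hWn
  have hφt : Tendsto φ atTop atTop := hφ.tendsto_atTop
  set ε : ℕ → ℝ := fun j => 1 / ((φ j : ℝ) + 1) with hε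
  have hεpos : ∀ j, 0 < ε j := fun j => by simp only [hε]; positivity
  have hεlim : Tendsto ε atTop (𝓝 0) := by
    have h1 : Tendsto (fun j => (φ j : ℝ) + 1) atTop atTop :=
      tendsto_atTop_add_const_right _ _ (tendsto_natCast_atTop_atTop.comp hφt)
    exact tendsto_const_nhds.div_atTop h1
  have hzero : W (-1) 0 = 0 :=
    hkill (fun j => Wn (φ j)) W ε hεpos hεlim (fun j => hWn (φ j)) hW (fun j => hPn (φ j))
      (fun t ht y => hpt t ht y) (fun t ht y => hgrad t ht y) (fun t ht => hlu t ht)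
  have hge : κ ≤ ‖W (-1) 0‖ :=
    ge_of_tendsto ((hpt (-1) (by norm_num) 0).norm) (Eventually.of_forall fun j => hκn (φ j))
  rw [hzero, norm_zero] at hge
  exact absurd hge (not_le.2 hκ)
/-! ## §3 MECHANISM, part 1 — Leray's EVERY-TIME floor and the PRESCRIBED-TIME (SNAPSHOT) ZOOM PACKAGE (LINE 36 §3, plus the
locally-uniform clause)

Leray's lower rate holds at EVERY instant of `[0, T)` (tree `leray_blowup_rate_top_holds`, with the sub-strip boundedness
`eLpNorm_uncurry_top_lt_top_of_tao2011` exactly as in the tree's proof of `typeICertificateLadder_rungZero`), so zoom centres can be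
placed at ANY prescribed instants — in particular inside any set of times hit frequently as `t ↑ T` — at `c_S`-fast points.  The
zoom carries a SNAPSHOT hypothesis at the times `t_k` to the single slice `s = −1` of the limit: values and gradients pointwise
(LINE 36) and values LOCALLY UNIFORMLY (this line; needed to read a needle whose direction and start MOVE with `k`). -/

-- `exists_fast_at`: the line restates the tree's `SnapshotTop.exists_fast_at`; taken BY NAME (gate lint dedup.landed).

-- `sqrt_mul_sq_mul`: the line restates the tree's `SnapshotTop.sqrt_mul_sq_mul`; taken BY NAME (gate lint dedup.landed).

/-- **THE SNAPSHOT ZOOM PACKAGE (prescribed times; LINE 36 + locally uniform slices).**  Let `u` be a classical Clay solution on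
`[0, T)` with dimensionless Type-I constant `M` which does NOT extend past `T`, and let `Q` be any property of instants hit
FREQUENTLY as `t ↑ T`.  Then there are scales `c_j ↓ 0`, centres `x_j` and a member `W ∈ 𝒦_M` (SAME `M`) such that: the centre
times `t_j = T − c_j²ν` all satisfy `Q`; each `x_j` is `c_S`-fast at `t_j`; the zooms `c_j u(T + c_j²ν s, x_j + c_jν y)` converge to
`W(s, y)` at every point of the open past together with their spatial gradients, AND LOCALLY UNIFORMLY IN `y` ON EVERY SLICE; and
`‖W(−1, 0)‖ ≥ c_S`. -/
theorem exists_snapshotZoom_package {ν T M : ℝ} (hν : 0 < ν) (hT : 0 < T)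
    {u : ℝ → E3 → E3} {p : ℝ → E3 → ℝ}
    (hsol : IsClassicalNSSolutionOn (Ico 0 T) ν 0 u p) (hLH : IsLerayHopfOn T ν 0 (u 0) u)
    (hdec : HasRapidSpatialDecay (u 0)) (hM : OneLevelTop.HasTypeIConstant ν T M u)
    (hmax : ¬ HasSmoothExtensionPast ν 0 u T) {Q : ℝ → Prop} (hQ : ∃ᶠ t in 𝓝[<] T, Q t) :
    ∃ (c : ℕ → ℝ) (x : ℕ → E3) (W : ℝ → E3 → E3),
      (∀ j, 0 < c j) ∧ Tendsto c atTop (𝓝 0) ∧ IsTypeIAncientMild M W ∧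
      (∀ j, Q (T + c j ^ 2 * ν * (-1))) ∧
      (∀ j, x j ∈ TwoTimeTop.topSet ν T u SnapshotTop.snapLevel (T + c j ^ 2 * ν * (-1))) ∧
      (∀ s < 0, ∀ y : E3,
        Tendsto (fun j => (c j * 1) • u (T + c j ^ 2 * ν * s) (x j + (c j * ν) • y)) atTop (𝓝 (W s y))) ∧
      (∀ s < 0, ∀ y : E3,
        Tendsto (fun j => fderiv ℝ (fun y' : E3 => (c j * 1) • u (T + c j ^ 2 * ν * s) (x j + (c j * ν) • y')) y)
          atTop (𝓝 (fderiv ℝ (W s) y))) ∧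
      (∀ s < 0, TendstoLocallyUniformly
        (fun j => fun y : E3 => (c j * 1) • u (T + c j ^ 2 * ν * s) (x j + (c j * ν) • y)) (W s) atTop) ∧
      SnapshotTop.snapLevel ≤ ‖W (-1) 0‖ := by
  -- ## (1) the rate window and the PRESCRIBED near-maximum sequence `(t_k, x_k)`: `Q t_k`, `T − t_k < δ/(k+2)`, `x_k` fast
  obtain ⟨δ, hδ, hδT, hrate⟩ := OneLevelTop.exists_window_of_hasTypeIConstant hT hM
  have hseq : ∀ k : ℕ, ∃ t : ℝ, ∃ x : E3, t ∈ Ioo (T - δ / ((k : ℝ) + 2)) T ∧ Q t ∧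
      SnapshotTop.snapLevel * Real.sqrt ν < Real.sqrt (T - t) * ‖u t x‖ := by
    intro k
    have hpos : 0 < δ / ((k : ℝ) + 2) := by positivity
    have hIoo : ∀ᶠ t in 𝓝[<] T, t ∈ Ioo (T - δ / ((k : ℝ) + 2)) T := Ioo_mem_nhdsLT (by linarith)
    have hIco : ∀ᶠ t in 𝓝[<] T, t ∈ Ico (0 : ℝ) T := Ico_mem_nhdsLT hT
    obtain ⟨t, hQt, htI, htIco⟩ := (hQ.and_eventually (hIoo.and hIco)).exists
    obtain ⟨x, hx⟩ := SnapshotTop.exists_fast_at hν hT hsol hLH hdec hmax htIco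
    exact ⟨t, x, htI, hQt, hx⟩
  choose t x htI hQt hfast using hseq
  have hTt : ∀ k, 0 < T - t k := fun k => sub_pos.2 (htI k).2
  have hTtδ : ∀ k, T - t k < δ / ((k : ℝ) + 2) := fun k => by linarith [(htI k).1]
  -- ## (2) scales `c_k = √((T − t_k)/ν)`: `c_k² ν = T − t_k`, `c_k → 0`
  set c : ℕ → ℝ := fun k => Real.sqrt ((T - t k) / ν) with hc
  have hcpos : ∀ k, 0 < c k := fun k => Real.sqrt_pos.2 (div_pos (hTt k) hν)
  have hc2 : ∀ k, c k ^ 2 * ν = T - t k := by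
    intro k
    simp only [hc]
    rw [Real.sq_sqrt (div_pos (hTt k) hν).le]
    field_simp
  have het : ∀ k, T + c k ^ 2 * ν * (-1) = t k := fun k => by rw [hc2 k]; ring
  have hclim : Tendsto c atTop (𝓝 0) := by
    have hk2 : Tendsto (fun k : ℕ => (k : ℝ) + 2) atTop atTop :=
      tendsto_atTop_add_const_right _ _ tendsto_natCast_atTop_atTop
    have hup0 : Tendsto (fun k : ℕ => δ / ((k : ℝ) + 2)) atTop (𝓝 0) := tendsto_const_nhds.div_atTop hk2
    have hupper : Tendsto (fun k : ℕ => δ / ((k : ℝ) + 2) / ν) atTop (𝓝 0) := by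
      simpa using hup0.div_const ν
    have h1 : Tendsto (fun k => (T - t k) / ν) atTop (𝓝 0) :=
      tendsto_of_tendsto_of_tendsto_of_le_of_le tendsto_const_nhds hupper
        (fun k => (div_pos (hTt k) hν).le) (fun k => div_le_div_of_nonneg_right (hTtδ k).le hν.le)
    have h2 := h1.sqrt
    rw [Real.sqrt_zero] at h2
    exact h2
  -- ## (3) the zooms and their windows `(A_k, 0)`, `A_k → −∞`
  have hα : (1 : ℝ) = ν / ν := (div_self hν.ne').symm
  have hβ : ν = ν ^ 2 / ν := by rw [sq, mul_div_cancel_right₀ _ hν.ne']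
  set w : ℕ → ℝ → E3 → E3 := fun k => (c k * 1) • stPull (c k ^ 2 * ν) (c k * ν) T (x k) u with hw
  set Aw : ℕ → ℝ := fun k => -(δ / (c k ^ 2 * ν)) with hA
  have hAwle : ∀ k, Aw k ≤ -((k : ℝ) + 2) := by
    intro k
    have hk : 0 < (k : ℝ) + 2 := by positivity
    have hprod : (T - t k) * ((k : ℝ) + 2) < δ := (lt_div_iff₀ hk).1 (hTtδ k)
    simp only [hA]
    rw [hc2 k, neg_le_neg_iff, le_div_iff₀ (hTt k)]
    linarith [mul_comm (T - t k) ((k : ℝ) + 2)]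
  have hAlim : Tendsto Aw atTop atBot := by
    have h1 : Tendsto (fun k : ℕ => -((k : ℝ) + 2)) atTop atBot :=
      tendsto_neg_atTop_atBot.comp (tendsto_atTop_add_const_right _ _ tendsto_natCast_atTop_atTop)
    exact tendsto_atBot_mono hAwle h1
  have hcW : ∀ k, ContinuousOn (uncurry (w k)) (Ioo (Aw k) 0 ×ˢ univ) := fun k =>
    zoom_continuousOn hν hsol hν hα hβ (hcpos k) hδT
  have hdivW : ∀ k, ∀ s ∈ Ioo (Aw k) 0, IsWeaklyDivFree (w k s) := fun k s hs =>
    zoom_isWeaklyDivFree hν hsol hν hα hβ (hcpos k) hδT hs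
  have hmildW : ∀ k, ∀ s s' : ℝ, Aw k < s → s < s' → s' < 0 → ∀ y,
      w k s' y = UnboundedOperators.heatExtension (w k s) (s' - s) y -
        oseenDuhamel 1 s (w k) (w k) s' y := fun k s s' hs hss' hs' y =>
    zoom_oseen hν hT hsol hLH hdec hν hα hβ (hcpos k) hδT hs hss' hs' y
  have hIW : ∀ k, ∀ s ∈ Ioo (Aw k) 0, ∀ y, ‖w k s y‖ ≤ M / Real.sqrt (-s) := by
    intro k s hs y
    have h : ‖w k s y‖ ≤ (1 * (M * Real.sqrt ν) / Real.sqrt ν) / Real.sqrt (-s) :=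
      zoom_norm_le (x₀ := x k) hν hα hβ hν (hcpos k) hδT hrate hs y
    have e : (1 : ℝ) * (M * Real.sqrt ν) / Real.sqrt ν = M := by
      rw [one_mul, mul_div_cancel_right₀ _ (Real.sqrt_pos.2 hν).ne']
    rw [e] at h
    exact h
  -- ## (4) extraction of a limit `W ∈ 𝒦_M` (SAME constant `M`), values and gradients pointwise, values locally uniformly
  obtain ⟨φ, hφ, W, hW, hpt, hgrad, hlu, -⟩ := exists_tendsto_of_typeI_seq_Ioo M hAlim hcW hdivW hmildW hIW
  have hφt : Tendsto φ atTop atTop := hφ.tendsto_atTop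
  -- ## (5) normalisation at `(−1, 0)`
  have hnorm : ∀ k, SnapshotTop.snapLevel ≤ ‖w k (-1) 0‖ := by
    intro k
    have e1 : w k (-1) 0 = (c k * 1) • u (T + c k ^ 2 * ν * (-1)) (x k + (c k * ν) • (0 : E3)) := by
      simp only [hw, smul_stPull_apply]
    rw [e1, smul_zero, add_zero, het, mul_one, norm_smul, Real.norm_eq_abs, abs_of_pos (hcpos k)]
    have hsq : Real.sqrt (T - t k) = c k * Real.sqrt ν := by
      rw [← hc2 k, Real.sqrt_mul (sq_nonneg _), Real.sqrt_sq (hcpos k).le]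
    have h2 : SnapshotTop.snapLevel * Real.sqrt ν < c k * ‖u (t k) (x k)‖ * Real.sqrt ν := by
      have h := hfast k
      rw [hsq] at h
      linarith [h, (by ring : c k * Real.sqrt ν * ‖u (t k) (x k)‖ = c k * ‖u (t k) (x k)‖ * Real.sqrt ν)]
    exact (lt_of_mul_lt_mul_right h2 (Real.sqrt_nonneg ν)).le
  have hge : SnapshotTop.snapLevel ≤ ‖W (-1) 0‖ :=
    ge_of_tendsto ((hpt (-1) (by norm_num) 0).norm) (Eventually.of_forall fun j => hnorm (φ j))
  -- ## (6) package along the subsequence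
  have hwu : ∀ (k : ℕ) (s : ℝ),
      w k s = fun y => (c k * 1) • u (T + c k ^ 2 * ν * s) (x k + (c k * ν) • y) :=
    fun k s => funext fun y => by simp only [hw, smul_stPull_apply]
  have hfastTop : ∀ k, x k ∈ TwoTimeTop.topSet ν T u SnapshotTop.snapLevel (T + c k ^ 2 * ν * (-1)) := by
    intro k
    rw [TwoTimeTop.mem_topSet, het]
    exact (hfast k).le
  refine ⟨fun j => c (φ j), fun j => x (φ j), W, fun j => hcpos _, hclim.comp hφt, hW,
    fun j => by rw [het]; exact hQt (φ j), fun j => hfastTop (φ j), fun s hs y => ?_, fun s hs y => ?_,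
    fun s hs => ?_, hge⟩
  · exact (hpt s hs y).congr fun j => by rw [hwu]
  · exact (hgrad s hs y).congr fun j => by rw [hwu]
  · intro U hU y
    obtain ⟨V, hV, hev⟩ := hlu s hs U hU y
    refine ⟨V, hV, ?_⟩
    filter_upwards [hev] with j hj z hz
    simpa only [hwu] using hj z hz

end Summit.NavierStokesRegularity.NavierStokesRegularity.Theorems.ScenarioCensus.NeedleTop

end
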